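/-
Copyright (c) 2026 the pub-hodgecm-mathlib formalisation cell (harness21).  Prover seat hodgecm-mathlib-K2E5-p15 (g3), HCML Track B «K2-LIT»,
h413 = `stmt-HodgeConjecture-24833`, (SC-an) line (lead K2E3-p14 (g3)), road «HC-14-ell», file E4 «THE `𝔲(2)` BASE CASE» — STRUCTURE FILE A
(dealer K2E3-plan (g2) deal (D45); lead RULINGS #7 (R7-1)∕(R7-2)).  2026-09-04.
-/
import Literature.NumberTheory.Automorphic.UnitaryGroupLineBorelRing       -- ★ A″ (F0P3a): `exists_borelHomeomorph_two`, `isClosed_torusU_two`, `mem_torusU_two_iff`; brings ★ A′ `LineRing` kit (`umat_*`, `torus_relations_two`, `exists_lineChart`)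
import Literature.NumberTheory.GaloisRepresentations.LocalField            -- ★ `IsNonarchimedeanLocalField.normAbs`
import Literature.NumberTheory.Automorphic.LocalFieldHaarBalls             -- ★ `LocalFieldHaar.continuous_normAbs`; brings ★ `TateLocalZetaShells.exists_normAbs_eq_inv`
import Mathlib.LinearAlgebra.Matrix.Charpoly.Disc
import HarnessLib

/-!
# h413 ∕ Track B «K2-LIT», road «HC-14-ell», file E4 — STRUCTURE FILE A: the orbit `b⁻¹ Y b` of an elliptic `Y ∈ 𝔲(σ, Φ₂)` in the Iwasawa coordinates `b = t·n`
# (`Z₁₀ = ν·y₁₀`, `Z₁₁ = y₁₁ + ν x·y₁₀`, `Z₀₁·Z₁₀ = −χ_Y(Z₁₁)`, `ν = d₀ σ(d₀)`), and «REGULAR ELLIPTIC ⇒ NO ISOTROPIC EIGENVECTOR» (`y₁₀ ≠ 0`, `χ_Y ≠ 0` on the line `y₁₁ + R⁻·y₁₀`)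

Cell `pub/hodgecm-mathlib`, crux H413 = `stmt-HodgeConjecture-24833` (lane `--supports … --as helper`, count-neutral); seat K2E5-p15 (g3); dealer K2E3-plan (g2)
deal (D45); (SC-an) line lead K2E3-p14 (g3) (RULINGS #7).  THEOREMS ONLY (no `def`, no `instance`, no `notation`, no named-fact hypothesis, no `sorry`); never
imports `Cruxes/…/Lines`.  First of the structure files behind §2 (E4-iso) of `Theorems/K2E3HC14EllBaseCaseU2.lean` — Harish-Chandra's Theorem 13 for the compact
Cartan subalgebras of `𝔲(1,1)` ([HarishChandra1970, Part V §3 Thm. 13 p. 51]) BY HAND in Iwasawa coordinates.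

THE MATHEMATICS.  `R` a commutative ring with an endomorphism `σ`, `J = Φ₂ = antidiag(1,1)` (★ `StdForm.antidiagonal 2`), `U = U(σ, Φ₂)(R)` (★ `unitaryGroupOfForm`) with its
★ `LineRing` subgroups `T₂ = torusU` (`t = diag(d₀, d₁)`, `σ(d₀) d₁ = 1`), `N₂ = unipotentU` (`n = [[1, x], [0, 1]]`, `σ x = −x`), `B₂ = borelU = T₂·N₂`.  For `Y ∈ M₂(R)` and
`b = t n`:  `Z := b⁻¹ Y b` has **`Z₁₀ = ν·y₁₀`**, **`Z₁₁ = y₁₁ + ν x·y₁₀`**, `ν := d₀ σ(d₀)` (§1, a four-line matrix product), `tr Z = tr Y`, `det Z = det Y`, hence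
**`Z₀₁·Z₁₀ = −χ_Y(Z₁₁)`** with `χ_Y(z) = z² − (tr Y) z + det Y` (§1, `det` of a `2 × 2`).  §2 (`R = K` a non-archimedean local field, `σ` valuation-preserving): the diagonal
torus `T₂ ≅ K^×` is CLOSED and NOT COMPACT (it contains `diag(ϖ^k, σ(ϖ)^{-k})`), so a regular `Y ∈ 𝔲(σ, Φ₂)` (`disc χ_Y ≠ 0`) with COMPACT centraliser in `U` has **no isotropic
eigenvector**: `y₁₀ ≠ 0`, `y₀₁ ≠ 0` (if `y₁₀ = 0` then `Y = [[ξ, q], [0, −σξ]]` is diagonalised by the unitary `n_x`, `x = q∕(−σξ − ξ) ∈ R⁻`, and `n_x T₂ n_x⁻¹` centralises `Y`),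
and — applied to the conjugates `n⁻¹ Y n`, which are again regular elliptic — **`χ_Y(y₁₁ + w·y₁₀) ≠ 0` for every `w ∈ R⁻`** (a root would make `n_w⁻¹ Y n_w` lower
triangular).  These are the two places where ellipticity enters the volume estimate of FILE C.

## References
* [HarishChandra1970] Harish-Chandra (notes by G. van Dijk), *Harmonic Analysis on Reductive p-adic Groups*, LNM 162 (1970), Part V §3 Thm. 13 p. 51; Part VI §8 Thm. 14.
* [Rogawski1990] J. D. Rogawski, *Automorphic Representations of Unitary Groups in Three Variables*, Ann. of Math. Stud. 123 (1990), §1.10 p. 9; §3.6 pp. 28–31.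
* [PlatonovRapinchuk1994] V. Platonov, A. Rapinchuk, *Algebraic Groups and Number Theory* (1994), §3.5 (compactness of anisotropic tori; split tori are non-compact).
-/

set_option autoImplicit false
set_option linter.dupNamespace false  -- the mandated namespace repeats the single-problem summit's segment (`HodgeConjecture.HodgeConjecture`)

noncomputable section

open Matrix Set Filter Topology
open scoped MatrixGroups NNReal
open Literature.NumberTheory.Automorphic Literature.NumberTheory.Automorphic.UnitaryGroup Literature.NumberTheory.Automorphic.UnitaryGroup.HeisRing
open Literature.NumberTheory.Automorphic.UnitaryGroup.LineRing
open Literature.NumberTheory.GaloisRepresentations Literature.NumberTheory.GaloisRepresentations.IsNonarchimedeanLocalField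

namespace Summit.HodgeConjecture.HodgeConjecture.Cruxes.H413.K2E3HC14EllU11Orbit

/-! ## §1 The orbit in Iwasawa coordinates (any commutative ring) -/

section Ring

variable {R : Type*} [CommRing R] (σ : R →+* R) {J : Matrix (Fin 2) (Fin 2) R} (hJ : J = (StdForm.antidiagonal 2).over R)

/-- A `2 × 2` matrix product: the four entries of `Z = [[1,−x],[0,1]]·diag(e)·Y·diag(d)·[[1,x],[0,1]]`:
`Z₀₀ = e₀y₀₀d₀ − x e₁y₁₀d₀`, `Z₀₁ = (e₀y₀₀d₀ − x e₁y₁₀d₀) x + e₀y₀₁d₁ − x e₁y₁₁d₁`, `Z₁₀ = e₁y₁₀d₀`, `Z₁₁ = e₁y₁₀d₀ x + e₁y₁₁d₁`. [cite: Rogawski1990, §1.10 p. 9] -/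
theorem conj_explicit_apply (Y : Matrix (Fin 2) (Fin 2) R) (d e : Fin 2 → R) (x : R) :
    (!![(1 : R), -x; 0, 1] * Matrix.diagonal e * Y * Matrix.diagonal d * !![(1 : R), x; 0, 1]) 0 0 = e 0 * Y 0 0 * d 0 - x * (e 1 * Y 1 0 * d 0) ∧
      (!![(1 : R), -x; 0, 1] * Matrix.diagonal e * Y * Matrix.diagonal d * !![(1 : R), x; 0, 1]) 0 1 =
          (e 0 * Y 0 0 * d 0 - x * (e 1 * Y 1 0 * d 0)) * x + e 0 * Y 0 1 * d 1 - x * (e 1 * Y 1 1 * d 1) ∧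
        (!![(1 : R), -x; 0, 1] * Matrix.diagonal e * Y * Matrix.diagonal d * !![(1 : R), x; 0, 1]) 1 0 = e 1 * Y 1 0 * d 0 ∧
          (!![(1 : R), -x; 0, 1] * Matrix.diagonal e * Y * Matrix.diagonal d * !![(1 : R), x; 0, 1]) 1 1 = e 1 * Y 1 0 * d 0 * x + e 1 * Y 1 1 * d 1 := by
  have hY : Y = !![Y 0 0, Y 0 1; Y 1 0, Y 1 1] := Matrix.eta_fin_two Y
  have hd : Matrix.diagonal d = !![d 0, 0; 0, d 1] := by
    ext i j; fin_cases i <;> fin_cases j <;> simp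
  have he : Matrix.diagonal e = !![e 0, 0; 0, e 1] := by
    ext i j; fin_cases i <;> fin_cases j <;> simp
  rw [hY, hd, he]
  simp only [Matrix.mul_fin_two]
  refine ⟨?_, ?_, ?_, ?_⟩ <;>
  · simp only [Matrix.of_apply, Matrix.cons_val', Matrix.cons_val_zero, Matrix.cons_val_one, Matrix.empty_val', Matrix.cons_val_fin_one]
    ring

/-- The matrix of `t = diag(d) ∈ T₂`. [cite: Rogawski1990, §1.10 p. 9] -/
theorem coe_torus_eq_diagonal {t : ↥(unitaryGroupOfForm σ J)} {d : Fin 2 → Rˣ} (hd : glDiagonal 2 R d = (t : GL (Fin 2) R)) :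
    ((t : GL (Fin 2) R) : Matrix (Fin 2) (Fin 2) R) = Matrix.diagonal fun k => (d k : R) := by
  rw [← hd, coe_glDiagonal]

/-- The matrix of `t⁻¹` for `t = diag(d) ∈ T₂`. [cite: Rogawski1990, §1.10 p. 9] -/
theorem coe_torus_inv_eq_diagonal {t : ↥(unitaryGroupOfForm σ J)} {d : Fin 2 → Rˣ} (hd : glDiagonal 2 R d = (t : GL (Fin 2) R)) :
    (((t : GL (Fin 2) R)⁻¹ : GL (Fin 2) R) : Matrix (Fin 2) (Fin 2) R) = Matrix.diagonal fun k => (((d k)⁻¹ : Rˣ) : R) := by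
  rw [← hd, ← map_inv, coe_glDiagonal]; rfl

/-- The matrix of `n ∈ N₂` is `[[1, x], [0, 1]]`, `x = n₀₁` (★ `umat_shape_two`). [cite: Rogawski1990, §1.10 p. 9] -/
theorem coe_unipotent_eq (n : ↥(unipotentU σ J)) :
    (((n : ↥(unitaryGroupOfForm σ J)) : GL (Fin 2) R) : Matrix (Fin 2) (Fin 2) R) =
      !![(1 : R), (((n : ↥(unitaryGroupOfForm σ J)) : GL (Fin 2) R) : Matrix (Fin 2) (Fin 2) R) 0 1; 0, 1] := by
  obtain ⟨h10, h00, h11⟩ := umat_shape_two σ n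
  ext i j; fin_cases i <;> fin_cases j
  · exact h00
  · rfl
  · exact h10
  · exact h11

/-- The matrix of `n⁻¹` for `n ∈ N₂` is `[[1, −x], [0, 1]]` (★ `umat_inv_zero_one_two`). [cite: Rogawski1990, §1.10 p. 9] -/
theorem coe_unipotent_inv_eq (n : ↥(unipotentU σ J)) :
    ((((n : ↥(unitaryGroupOfForm σ J)) : GL (Fin 2) R)⁻¹ : GL (Fin 2) R) : Matrix (Fin 2) (Fin 2) R) =
      !![(1 : R), -(((n : ↥(unitaryGroupOfForm σ J)) : GL (Fin 2) R) : Matrix (Fin 2) (Fin 2) R) 0 1; 0, 1] := by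
  have h : (((n : ↥(unitaryGroupOfForm σ J)) : GL (Fin 2) R)⁻¹ : GL (Fin 2) R) = (((n⁻¹ : ↥(unipotentU σ J)) : ↥(unitaryGroupOfForm σ J)) : GL (Fin 2) R) := by
    rw [Subgroup.coe_inv, Subgroup.coe_inv]
  rw [h, coe_unipotent_eq σ (n⁻¹), umat_inv_zero_one_two]

include hJ in
/-- **THE ORBIT IN IWASAWA COORDINATES.**  For `t = diag(d) ∈ T₂`, `n ∈ N₂` with `x = n₀₁`, `g = t·n` and any `Y ∈ M₂(R)`, the conjugate `Z = g⁻¹ Y g` has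
`Z₁₀ = ν·y₁₀` and `Z₁₁ = y₁₁ + ν x·y₁₀` with `ν = d₀ σ(d₀)` (the torus relation `σ(d₀) d₁ = 1`, ★ `torus_relations_two`, gives `d₁⁻¹ = σ d₀`).
[cite: HarishChandra1970, Part V §3 Thm. 13 p. 51] [cite: Rogawski1990, §1.10 p. 9] -/
theorem conj_torus_unipotent_apply {t : ↥(unitaryGroupOfForm σ J)} (ht : t ∈ torusU σ J) {d : Fin 2 → Rˣ} (hd : glDiagonal 2 R d = (t : GL (Fin 2) R))
    (n : ↥(unipotentU σ J)) (Y : Matrix (Fin 2) (Fin 2) R) {g : GL (Fin 2) R} (hg : g = (t : GL (Fin 2) R) * ((n : ↥(unitaryGroupOfForm σ J)) : GL (Fin 2) R)) :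
    (((g⁻¹ : GL (Fin 2) R) : Matrix (Fin 2) (Fin 2) R) * Y * (g : Matrix (Fin 2) (Fin 2) R)) 1 0 = ((d 0 : R) * σ (d 0 : R)) * Y 1 0 ∧
      (((g⁻¹ : GL (Fin 2) R) : Matrix (Fin 2) (Fin 2) R) * Y * (g : Matrix (Fin 2) (Fin 2) R)) 1 1 =
        Y 1 1 + ((d 0 : R) * σ (d 0 : R)) * (((n : ↥(unitaryGroupOfForm σ J)) : GL (Fin 2) R) : Matrix (Fin 2) (Fin 2) R) 0 1 * Y 1 0 := by
  obtain ⟨-, h01⟩ := torus_relations_two σ hJ ⟨t, ht⟩ hd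
  have hinv1 : (((d 1)⁻¹ : Rˣ) : R) = σ (d 0 : R) := by
    rw [← mul_one (((d 1)⁻¹ : Rˣ) : R), ← h01, mul_comm (σ (d 0 : R)) (d 1 : R), ← mul_assoc, Units.inv_mul, one_mul]
  have hinv1' : (((d 1)⁻¹ : Rˣ) : R) * (d 1 : R) = 1 := Units.inv_mul (d 1)
  set x := (((n : ↥(unitaryGroupOfForm σ J)) : GL (Fin 2) R) : Matrix (Fin 2) (Fin 2) R) 0 1 with hx
  have hn := coe_unipotent_eq σ n
  have hni := coe_unipotent_inv_eq σ n
  rw [← hx] at hn hni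
  have hprod : ((g⁻¹ : GL (Fin 2) R) : Matrix (Fin 2) (Fin 2) R) * Y * (g : Matrix (Fin 2) (Fin 2) R) =
      !![(1 : R), -x; 0, 1] * Matrix.diagonal (fun k => (((d k)⁻¹ : Rˣ) : R)) * Y * Matrix.diagonal (fun k => (d k : R)) * !![(1 : R), x; 0, 1] := by
    rw [hg, _root_.mul_inv_rev, Units.val_mul, Units.val_mul, hni, coe_torus_inv_eq_diagonal σ hd, coe_torus_eq_diagonal σ hd, hn]
    simp only [Matrix.mul_assoc]
  obtain ⟨-, -, h10, h11⟩ := conj_explicit_apply Y (fun k => (d k : R)) (fun k => (((d k)⁻¹ : Rˣ) : R)) x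
  rw [hprod]
  refine ⟨?_, ?_⟩
  · rw [h10]
    linear_combination (Y 1 0 * (d 0 : R)) * hinv1
  · rw [h11]
    linear_combination (Y 1 0 * (d 0 : R) * x) * hinv1 + Y 1 1 * hinv1'

/-- **Conjugation by `n ∈ N₂` alone** (`x = n₀₁`): `Z = n⁻¹ Y n` has `Z₀₀ = y₀₀ − x y₁₀`, `Z₀₁ = (y₀₀ − x y₁₀) x + y₀₁ − x y₁₁`, `Z₁₀ = y₁₀`, `Z₁₁ = y₁₀ x + y₁₁`.
[cite: Rogawski1990, §1.10 p. 9] -/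
theorem conj_unipotent_apply (n : ↥(unipotentU σ J)) (Y : Matrix (Fin 2) (Fin 2) R) {g : GL (Fin 2) R} (hg : g = ((n : ↥(unitaryGroupOfForm σ J)) : GL (Fin 2) R)) :
    (((g⁻¹ : GL (Fin 2) R) : Matrix (Fin 2) (Fin 2) R) * Y * (g : Matrix (Fin 2) (Fin 2) R)) 0 0 =
        Y 0 0 - (((n : ↥(unitaryGroupOfForm σ J)) : GL (Fin 2) R) : Matrix (Fin 2) (Fin 2) R) 0 1 * Y 1 0 ∧
      (((g⁻¹ : GL (Fin 2) R) : Matrix (Fin 2) (Fin 2) R) * Y * (g : Matrix (Fin 2) (Fin 2) R)) 0 1 =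
          (Y 0 0 - (((n : ↥(unitaryGroupOfForm σ J)) : GL (Fin 2) R) : Matrix (Fin 2) (Fin 2) R) 0 1 * Y 1 0) *
              (((n : ↥(unitaryGroupOfForm σ J)) : GL (Fin 2) R) : Matrix (Fin 2) (Fin 2) R) 0 1 +
            Y 0 1 - (((n : ↥(unitaryGroupOfForm σ J)) : GL (Fin 2) R) : Matrix (Fin 2) (Fin 2) R) 0 1 * Y 1 1 ∧
        (((g⁻¹ : GL (Fin 2) R) : Matrix (Fin 2) (Fin 2) R) * Y * (g : Matrix (Fin 2) (Fin 2) R)) 1 0 = Y 1 0 ∧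
          (((g⁻¹ : GL (Fin 2) R) : Matrix (Fin 2) (Fin 2) R) * Y * (g : Matrix (Fin 2) (Fin 2) R)) 1 1 =
            Y 1 0 * (((n : ↥(unitaryGroupOfForm σ J)) : GL (Fin 2) R) : Matrix (Fin 2) (Fin 2) R) 0 1 + Y 1 1 := by
  set x := (((n : ↥(unitaryGroupOfForm σ J)) : GL (Fin 2) R) : Matrix (Fin 2) (Fin 2) R) 0 1 with hx
  have hn := coe_unipotent_eq σ n
  have hni := coe_unipotent_inv_eq σ n
  rw [← hx] at hn hni
  have hprod : ((g⁻¹ : GL (Fin 2) R) : Matrix (Fin 2) (Fin 2) R) * Y * (g : Matrix (Fin 2) (Fin 2) R) =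
      !![(1 : R), -x; 0, 1] * Matrix.diagonal (fun _ => (1 : R)) * Y * Matrix.diagonal (fun _ => (1 : R)) * !![(1 : R), x; 0, 1] := by
    rw [hg, hni, hn, Matrix.diagonal_one, Matrix.mul_one, Matrix.mul_one]
  obtain ⟨h00, h01, h10, h11⟩ := conj_explicit_apply Y (fun _ => (1 : R)) (fun _ => (1 : R)) x
  rw [hprod, h00, h01, h10, h11]
  refine ⟨?_, ?_, ?_, ?_⟩ <;> ring

/-- **`Z₀₁·Z₁₀ = −χ_Y(Z₁₁)` for every conjugate `Z = g⁻¹ Y g`** of a `2 × 2` matrix (`tr Z = tr Y`, `det Z = det Y`, and `det Z = Z₀₀Z₁₁ − Z₀₁Z₁₀`,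
`Z₀₀ = tr Y − Z₁₁`): the off-diagonal product is the value of the characteristic polynomial `χ_Y(z) = z² − (tr Y) z + det Y` at the diagonal entry, up to sign.
[cite: HarishChandra1970, Part V §3 Thm. 13 p. 51] -/
theorem conj_apply_zero_one_mul_apply_one_zero (g : GL (Fin 2) R) (Y : Matrix (Fin 2) (Fin 2) R) :
    (((g⁻¹ : GL (Fin 2) R) : Matrix (Fin 2) (Fin 2) R) * Y * (g : Matrix (Fin 2) (Fin 2) R)) 0 1 *
        (((g⁻¹ : GL (Fin 2) R) : Matrix (Fin 2) (Fin 2) R) * Y * (g : Matrix (Fin 2) (Fin 2) R)) 1 0 =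
      -(((((g⁻¹ : GL (Fin 2) R) : Matrix (Fin 2) (Fin 2) R) * Y * (g : Matrix (Fin 2) (Fin 2) R)) 1 1) ^ 2 -
          Matrix.trace Y * (((g⁻¹ : GL (Fin 2) R) : Matrix (Fin 2) (Fin 2) R) * Y * (g : Matrix (Fin 2) (Fin 2) R)) 1 1 + Y.det) := by
  set Z := ((g⁻¹ : GL (Fin 2) R) : Matrix (Fin 2) (Fin 2) R) * Y * (g : Matrix (Fin 2) (Fin 2) R) with hZ
  have htr : Matrix.trace Z = Matrix.trace Y := Matrix.trace_units_conj' g Y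
  have hdet : Z.det = Y.det := Matrix.det_units_conj' g Y
  rw [Matrix.trace_fin_two] at htr
  rw [Matrix.det_fin_two] at hdet
  have h00 : Z 0 0 = Matrix.trace Y - Z 1 1 := by rw [← htr]; ring
  linear_combination (-1 : R) * hdet + Z 1 1 * h00

end Ring

/-! ## §2 The Lie algebra `𝔲(σ, Φ₂)` in coordinates; conjugation preserves it -/

section LieRing

variable {R : Type*} [CommRing R] (σ : R →+* R) {J : Matrix (Fin 2) (Fin 2) R} (hJ : J = (StdForm.antidiagonal 2).over R)

/-- `Φ₂ = [[0, 1], [1, 0]]`. [cite: Rogawski1990, §1.10 p. 9] -/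
theorem antidiagonal_two_over_eq : (StdForm.antidiagonal 2).over R = !![(0 : R), 1; 1, 0] := by
  ext i j
  rw [StdForm.over, Matrix.map_apply, StdForm.antidiagonal_J_apply]
  fin_cases i <;> fin_cases j
  · show Int.castRingHom R (if (0 : Fin 2) = Fin.rev 0 then 1 else 0) = 0
    rw [if_neg (by decide), map_zero]
  · show Int.castRingHom R (if (1 : Fin 2) = Fin.rev 0 then 1 else 0) = 1
    rw [if_pos (by decide), map_one]
  · show Int.castRingHom R (if (0 : Fin 2) = Fin.rev 1 then 1 else 0) = 1
    rw [if_pos (by decide), map_one]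
  · show Int.castRingHom R (if (1 : Fin 2) = Fin.rev 1 then 1 else 0) = 0
    rw [if_neg (by decide), map_zero]

include hJ in
/-- **The relations of `𝔲(σ, Φ₂)`**: `Y ∈ 𝔲` (`ᵗ(σY) Φ₂ + Φ₂ Y = 0`) iff `σ y₁₀ = −y₁₀`, `σ y₀₁ = −y₀₁`, `y₁₁ = −σ y₀₀` (and `y₀₀ = −σ y₁₁`).
[cite: Rogawski1990, §1.10 p. 9] -/
theorem lie_relations_two {Y : Matrix (Fin 2) (Fin 2) R} (hY : (Y.map σ)ᵀ * J + J * Y = 0) :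
    σ (Y 1 0) = -Y 1 0 ∧ σ (Y 0 1) = -Y 0 1 ∧ Y 1 1 = -σ (Y 0 0) ∧ Y 0 0 = -σ (Y 1 1) := by
  subst hJ
  rw [antidiagonal_two_over_eq] at hY
  have h := fun i j => congrFun (congrFun hY i) j
  have h00 := h 0 0; have h01 := h 0 1; have h10 := h 1 0; have h11 := h 1 1
  simp only [Matrix.add_apply, Matrix.mul_apply, Fin.sum_univ_two, Matrix.transpose_apply, Matrix.map_apply, Matrix.of_apply, Matrix.cons_val',
    Matrix.cons_val_zero, Matrix.cons_val_one, Matrix.empty_val', Matrix.cons_val_fin_one, Matrix.zero_apply] at h00 h01 h10 h11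
  refine ⟨?_, ?_, ?_, ?_⟩
  · linear_combination h00
  · linear_combination h11
  · linear_combination h01
  · linear_combination h10

/-- **Conjugation by a unitary element preserves `𝔲(σ, J)`**: `u ∈ U(σ, J)`, `ᵗ(σY) J + J Y = 0` ⇒ the same for `u⁻¹ Y u` (any form `J`, any commutative ring:
`ᵗ(σ(u⁻¹Yu)) J + J u⁻¹Yu = ᵗ(σu) (ᵗ(σY) J + J Y) u` by `J u⁻¹ = ᵗ(σu) J` and `ᵗ(σu⁻¹) J = J u`). [cite: PlatonovRapinchuk1994, §3.5] -/
theorem conj_mem_lie (J' : Matrix (Fin 2) (Fin 2) R) (u : ↥(unitaryGroupOfForm σ J')) {Y : Matrix (Fin 2) (Fin 2) R} (hY : (Y.map σ)ᵀ * J' + J' * Y = 0) :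
    (((((u : GL (Fin 2) R)⁻¹ : GL (Fin 2) R) : Matrix (Fin 2) (Fin 2) R) * Y * (u : GL (Fin 2) R)).map σ)ᵀ * J' +
      J' * ((((u : GL (Fin 2) R)⁻¹ : GL (Fin 2) R) : Matrix (Fin 2) (Fin 2) R) * Y * (u : GL (Fin 2) R)) = 0 := by
  have hu : (((u : GL (Fin 2) R) : Matrix (Fin 2) (Fin 2) R).map σ)ᵀ * J' * (u : GL (Fin 2) R) = J' := mem_unitaryGroupOfForm_iff.1 u.2
  have hui : ((((u : GL (Fin 2) R)⁻¹ : GL (Fin 2) R) : Matrix (Fin 2) (Fin 2) R).map σ)ᵀ * J' * (((u : GL (Fin 2) R)⁻¹ : GL (Fin 2) R) : Matrix (Fin 2) (Fin 2) R) = J' := by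
    have := mem_unitaryGroupOfForm_iff.1 (u⁻¹).2
    rwa [Subgroup.coe_inv] at this
  have hinv : ((u : GL (Fin 2) R) : Matrix (Fin 2) (Fin 2) R) * (((u : GL (Fin 2) R)⁻¹ : GL (Fin 2) R) : Matrix (Fin 2) (Fin 2) R) = 1 := by
    rw [← Units.val_mul, mul_inv_cancel, Units.val_one]
  -- `J' u⁻¹ = ᵗ(σu) J'` and `ᵗ(σ u⁻¹) J' = J' u`
  have h1 : J' * (((u : GL (Fin 2) R)⁻¹ : GL (Fin 2) R) : Matrix (Fin 2) (Fin 2) R) = (((u : GL (Fin 2) R) : Matrix (Fin 2) (Fin 2) R).map σ)ᵀ * J' := by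
    calc J' * (((u : GL (Fin 2) R)⁻¹ : GL (Fin 2) R) : Matrix (Fin 2) (Fin 2) R)
        = (((u : GL (Fin 2) R) : Matrix (Fin 2) (Fin 2) R).map σ)ᵀ * J' * ((u : GL (Fin 2) R) * (((u : GL (Fin 2) R)⁻¹ : GL (Fin 2) R) : Matrix (Fin 2) (Fin 2) R)) := by
          rw [← Matrix.mul_assoc, hu]
      _ = (((u : GL (Fin 2) R) : Matrix (Fin 2) (Fin 2) R).map σ)ᵀ * J' := by rw [hinv, Matrix.mul_one]
  have h2 : ((((u : GL (Fin 2) R)⁻¹ : GL (Fin 2) R) : Matrix (Fin 2) (Fin 2) R).map σ)ᵀ * J' = J' * (u : GL (Fin 2) R) := by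
    calc ((((u : GL (Fin 2) R)⁻¹ : GL (Fin 2) R) : Matrix (Fin 2) (Fin 2) R).map σ)ᵀ * J'
        = ((((u : GL (Fin 2) R)⁻¹ : GL (Fin 2) R) : Matrix (Fin 2) (Fin 2) R).map σ)ᵀ * J' *
            ((((u : GL (Fin 2) R)⁻¹ : GL (Fin 2) R) : Matrix (Fin 2) (Fin 2) R) * (u : GL (Fin 2) R)) := by
          rw [← Units.val_mul, inv_mul_cancel, Units.val_one, Matrix.mul_one]
      _ = J' * (u : GL (Fin 2) R) := by rw [← Matrix.mul_assoc, hui]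
  rw [Matrix.map_mul, Matrix.map_mul, Matrix.transpose_mul, Matrix.transpose_mul]
  calc (((u : GL (Fin 2) R) : Matrix (Fin 2) (Fin 2) R).map σ)ᵀ * ((Y.map σ)ᵀ * ((((u : GL (Fin 2) R)⁻¹ : GL (Fin 2) R) : Matrix (Fin 2) (Fin 2) R).map σ)ᵀ) * J' +
        J' * ((((u : GL (Fin 2) R)⁻¹ : GL (Fin 2) R) : Matrix (Fin 2) (Fin 2) R) * Y * (u : GL (Fin 2) R))
      = (((u : GL (Fin 2) R) : Matrix (Fin 2) (Fin 2) R).map σ)ᵀ * (Y.map σ)ᵀ * (((((u : GL (Fin 2) R)⁻¹ : GL (Fin 2) R) : Matrix (Fin 2) (Fin 2) R).map σ)ᵀ * J') +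
          J' * (((u : GL (Fin 2) R)⁻¹ : GL (Fin 2) R) : Matrix (Fin 2) (Fin 2) R) * Y * (u : GL (Fin 2) R) := by simp only [Matrix.mul_assoc]
    _ = (((u : GL (Fin 2) R) : Matrix (Fin 2) (Fin 2) R).map σ)ᵀ * ((Y.map σ)ᵀ * J' + J' * Y) * (u : GL (Fin 2) R) := by
          rw [h2, h1]; simp only [Matrix.mul_assoc, Matrix.mul_add, Matrix.add_mul]
    _ = 0 := by rw [hY, Matrix.mul_zero, Matrix.zero_mul]

/-- The centraliser set of a conjugate: `{g | g (u⁻¹Yu) g⁻¹ = u⁻¹Yu} = (g ↦ u⁻¹ g u) '' {g | g Y g⁻¹ = Y}`. [cite: PlatonovRapinchuk1994, §3.5] -/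
theorem centralizerSet_conj_eq (J' : Matrix (Fin 2) (Fin 2) R) (u : ↥(unitaryGroupOfForm σ J')) (Y : Matrix (Fin 2) (Fin 2) R) :
    {g : ↥(unitaryGroupOfForm σ J') | ((g : GL (Fin 2) R) : Matrix (Fin 2) (Fin 2) R) *
        ((((u : GL (Fin 2) R)⁻¹ : GL (Fin 2) R) : Matrix (Fin 2) (Fin 2) R) * Y * (u : GL (Fin 2) R)) * (((g : GL (Fin 2) R)⁻¹ : GL (Fin 2) R) : Matrix (Fin 2) (Fin 2) R) =
        (((u : GL (Fin 2) R)⁻¹ : GL (Fin 2) R) : Matrix (Fin 2) (Fin 2) R) * Y * (u : GL (Fin 2) R)} =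
      (fun g : ↥(unitaryGroupOfForm σ J') => u⁻¹ * g * u) ''
        {g : ↥(unitaryGroupOfForm σ J') | ((g : GL (Fin 2) R) : Matrix (Fin 2) (Fin 2) R) * Y * (((g : GL (Fin 2) R)⁻¹ : GL (Fin 2) R) : Matrix (Fin 2) (Fin 2) R) = Y} := by
  -- abbreviations for the unit matrices
  have key : ∀ g : ↥(unitaryGroupOfForm σ J'),
      ((g : GL (Fin 2) R) : Matrix (Fin 2) (Fin 2) R) * ((((u : GL (Fin 2) R)⁻¹ : GL (Fin 2) R) : Matrix (Fin 2) (Fin 2) R) * Y * (u : GL (Fin 2) R)) *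
          (((g : GL (Fin 2) R)⁻¹ : GL (Fin 2) R) : Matrix (Fin 2) (Fin 2) R) =
        (((u : GL (Fin 2) R)⁻¹ : GL (Fin 2) R) : Matrix (Fin 2) (Fin 2) R) * Y * (u : GL (Fin 2) R) ↔
      (((u * g * u⁻¹ : ↥(unitaryGroupOfForm σ J')) : GL (Fin 2) R) : Matrix (Fin 2) (Fin 2) R) * Y *
          ((((u * g * u⁻¹ : ↥(unitaryGroupOfForm σ J')) : GL (Fin 2) R)⁻¹ : GL (Fin 2) R) : Matrix (Fin 2) (Fin 2) R) = Y := by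
    intro g
    have e1 : (((u * g * u⁻¹ : ↥(unitaryGroupOfForm σ J')) : GL (Fin 2) R) : Matrix (Fin 2) (Fin 2) R) =
        ((u : GL (Fin 2) R) : Matrix (Fin 2) (Fin 2) R) * (g : GL (Fin 2) R) * (((u : GL (Fin 2) R)⁻¹ : GL (Fin 2) R) : Matrix (Fin 2) (Fin 2) R) := by
      rw [Subgroup.coe_mul, Subgroup.coe_mul, Subgroup.coe_inv, Units.val_mul, Units.val_mul]
    have e2 : ((((u * g * u⁻¹ : ↥(unitaryGroupOfForm σ J')) : GL (Fin 2) R)⁻¹ : GL (Fin 2) R) : Matrix (Fin 2) (Fin 2) R) =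
        ((u : GL (Fin 2) R) : Matrix (Fin 2) (Fin 2) R) * (((g : GL (Fin 2) R)⁻¹ : GL (Fin 2) R) : Matrix (Fin 2) (Fin 2) R) *
          (((u : GL (Fin 2) R)⁻¹ : GL (Fin 2) R) : Matrix (Fin 2) (Fin 2) R) := by
      rw [Subgroup.coe_mul, Subgroup.coe_mul, Subgroup.coe_inv, _root_.mul_inv_rev, _root_.mul_inv_rev, inv_inv, Units.val_mul, Units.val_mul, Matrix.mul_assoc]
    have hUi : (((u : GL (Fin 2) R)⁻¹ : GL (Fin 2) R) : Matrix (Fin 2) (Fin 2) R) * (u : GL (Fin 2) R) = 1 := by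
      rw [← Units.val_mul, inv_mul_cancel, Units.val_one]
    have hU : ((u : GL (Fin 2) R) : Matrix (Fin 2) (Fin 2) R) * (((u : GL (Fin 2) R)⁻¹ : GL (Fin 2) R) : Matrix (Fin 2) (Fin 2) R) = 1 := by
      rw [← Units.val_mul, mul_inv_cancel, Units.val_one]
    rw [e1, e2]
    constructor
    · intro h
      calc ((u : GL (Fin 2) R) : Matrix (Fin 2) (Fin 2) R) * (g : GL (Fin 2) R) * (((u : GL (Fin 2) R)⁻¹ : GL (Fin 2) R) : Matrix (Fin 2) (Fin 2) R) * Y *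
            (((u : GL (Fin 2) R) : Matrix (Fin 2) (Fin 2) R) * (((g : GL (Fin 2) R)⁻¹ : GL (Fin 2) R) : Matrix (Fin 2) (Fin 2) R) *
              (((u : GL (Fin 2) R)⁻¹ : GL (Fin 2) R) : Matrix (Fin 2) (Fin 2) R))
          = ((u : GL (Fin 2) R) : Matrix (Fin 2) (Fin 2) R) *
              (((g : GL (Fin 2) R) : Matrix (Fin 2) (Fin 2) R) * ((((u : GL (Fin 2) R)⁻¹ : GL (Fin 2) R) : Matrix (Fin 2) (Fin 2) R) * Y * (u : GL (Fin 2) R)) *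
                (((g : GL (Fin 2) R)⁻¹ : GL (Fin 2) R) : Matrix (Fin 2) (Fin 2) R)) * (((u : GL (Fin 2) R)⁻¹ : GL (Fin 2) R) : Matrix (Fin 2) (Fin 2) R) := by
              simp only [Matrix.mul_assoc]
        _ = ((u : GL (Fin 2) R) : Matrix (Fin 2) (Fin 2) R) * ((((u : GL (Fin 2) R)⁻¹ : GL (Fin 2) R) : Matrix (Fin 2) (Fin 2) R) * Y * (u : GL (Fin 2) R)) *
              (((u : GL (Fin 2) R)⁻¹ : GL (Fin 2) R) : Matrix (Fin 2) (Fin 2) R) := by rw [h]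
        _ = Y := by
              calc _ = (((u : GL (Fin 2) R) : Matrix (Fin 2) (Fin 2) R) * (((u : GL (Fin 2) R)⁻¹ : GL (Fin 2) R) : Matrix (Fin 2) (Fin 2) R)) * Y *
                    (((u : GL (Fin 2) R) : Matrix (Fin 2) (Fin 2) R) * (((u : GL (Fin 2) R)⁻¹ : GL (Fin 2) R) : Matrix (Fin 2) (Fin 2) R)) := by simp only [Matrix.mul_assoc]
                _ = Y := by rw [hU, Matrix.one_mul, Matrix.mul_one]
    · intro h
      calc (g : GL (Fin 2) R) * ((((u : GL (Fin 2) R)⁻¹ : GL (Fin 2) R) : Matrix (Fin 2) (Fin 2) R) * Y * (u : GL (Fin 2) R)) *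
            (((g : GL (Fin 2) R)⁻¹ : GL (Fin 2) R) : Matrix (Fin 2) (Fin 2) R)
          = ((((u : GL (Fin 2) R)⁻¹ : GL (Fin 2) R) : Matrix (Fin 2) (Fin 2) R) * (u : GL (Fin 2) R)) *
              ((g : GL (Fin 2) R) * (((u : GL (Fin 2) R)⁻¹ : GL (Fin 2) R) : Matrix (Fin 2) (Fin 2) R) * Y * ((u : GL (Fin 2) R) * (((g : GL (Fin 2) R)⁻¹ : GL (Fin 2) R) : Matrix (Fin 2) (Fin 2) R))) *
              ((((u : GL (Fin 2) R)⁻¹ : GL (Fin 2) R) : Matrix (Fin 2) (Fin 2) R) * (u : GL (Fin 2) R)) := by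
              rw [hUi, Matrix.one_mul, Matrix.mul_one]; simp only [Matrix.mul_assoc]
        _ = (((u : GL (Fin 2) R)⁻¹ : GL (Fin 2) R) : Matrix (Fin 2) (Fin 2) R) *
              (((u : GL (Fin 2) R) : Matrix (Fin 2) (Fin 2) R) * (g : GL (Fin 2) R) * (((u : GL (Fin 2) R)⁻¹ : GL (Fin 2) R) : Matrix (Fin 2) (Fin 2) R) * Y *
                (((u : GL (Fin 2) R) : Matrix (Fin 2) (Fin 2) R) * (((g : GL (Fin 2) R)⁻¹ : GL (Fin 2) R) : Matrix (Fin 2) (Fin 2) R) *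
                  (((u : GL (Fin 2) R)⁻¹ : GL (Fin 2) R) : Matrix (Fin 2) (Fin 2) R))) * (u : GL (Fin 2) R) := by simp only [Matrix.mul_assoc]
        _ = (((u : GL (Fin 2) R)⁻¹ : GL (Fin 2) R) : Matrix (Fin 2) (Fin 2) R) * Y * (u : GL (Fin 2) R) := by rw [h]
  ext g
  simp only [Set.mem_setOf_eq, Set.mem_image]
  constructor
  · intro h
    refine ⟨u * g * u⁻¹, (key g).1 h, by group⟩
  · rintro ⟨g', hg', rfl⟩
    refine (key (u⁻¹ * g' * u)).2 ?_
    have : u * (u⁻¹ * g' * u) * u⁻¹ = g' := by group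
    rw [this]; exact hg'

end LieRing

end Summit.HodgeConjecture.HodgeConjecture.Cruxes.H413.K2E3HC14EllU11Orbit

end
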